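import Summits.QuantumFields.YangMills.Theorems.UnitScaleTiltProp7LocalDivergenceComparison
import HarnessLib

/-!
# Route `UnitScaleTilt`, crux K1 «MinimiserStabilityRegPr» (stmt-QuantumFields-19200), EX row `hGF` (curved member), the LOD line (★p1 g24 `LOCATE-L6-ASSEMBLY`, road (α) of
# 2026-08-29 23:17Z «`P_V = Ad_{g̃}P_1Ad_{g̃}⁻¹` EXACTLY and globally»; ★★OWNER RULINGS №33 ∕ №34) — **THE MEMBER `Φ`∕`Ψ`∕`hΔ` ROWS FOR (L5″): EXACT GAUGE COVARIANCE OF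
# `D_{U₀}` (3.3), `D*_{U₀}` (3.8) AND `Δ^η_{U₀} = D*D` (3.23) UNDER `(U₀, λ, A) ↦ (U₀^σ, Ad_σλ, Ad_σA)`, WITH THE CONJUGATIONS PACKAGED AS LINEAR ISOMETRIES OF THE
# WEIGHTED `L²` SPACES** — the hypotheses `hΔ`, `hD` and the `DL2` row of ✓`Prop7ProjectorGaugeCovariance` (routeR-w3 g12, ⧗∕✓p751242) at the T³ member, token for token.

Cell `ym3-torus` (HUMAN RULING D-0037: YM₃ on T³ is ladder rung R3 — NOT d = 4, NOT infinite volume, NOT a mass gap, NOT Clay).  Width seat `ym3-torus-px12` (gen 13);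
routeR-w3 g12 2026-08-29 23:41Z «px12 TAKE THE MEMBER `Φ`∕`hΔ` ROWS — YES» (their scratch `SCRATCH-adSiteIso.rc0.routeRw3g12.lean` a559a957 is §3's `exists_adSite`, taken verbatim with
thanks).  THEOREMS ONLY (0 `def`, 0 `sorry`); `--supports stmt-QuantumFields-19200 --as helper`, count-neutral.  HONEST LABEL (№33 (6)): supplier rows of the curved γ-row line;
the `D`-twin of ✓`Prop7LocalDivergenceComparison` §3 (p750237); nothing of (3.49), Thm 3.3∕3.11, `hGF`, `h349`, EX or the crux proved; NOT (L5a)'s curl rows (w7 g11).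

THE MATHEMATICS ([Balaban1985BackgroundPropagators] p. 393: «all the operators … are covariant with respect to gauge transformations»).  With `U₀^σ(b) = σ(b₋)U₀(b)σ(b₊)⁻¹`
(`GaugeField.gaugeAct`), `(Ad_σλ)(x) = σ(x)λ(x)σ(x)*` on site functions and `(Ad_σA)(b) = σ(b₋)A(b)σ(b₋)*` on vector fields:
(3.3) `(D_{U₀^σ}(Ad_σλ))(b) = η⁻¹(U₀^σ(b)·σ(b₊)λ(b₊)σ(b₊)*·U₀^σ(b)* − σ(b₋)λ(b₋)σ(b₋)*) = σ(b₋)·(D_{U₀}λ)(b)·σ(b₋)*` (`σ(b₊)⁻¹σ(b₊) = 1`); (3.8) is ✓p750237's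
`toL2S_symm_DstarL2_gaugeAct_conj`; (3.23) composes the two.  Both conjugations preserve the Frobenius weights (✓`norm_toL2S_conj_eq`, ✓`norm_toL2_conj_eq`), so they are
linear ISOMETRIES `Φ_σ` of `SiteL2K` and `Ψ_σ` of `BondL2K` (stated as `∃`, definition-free), and the three operators are intertwined:
`D_{U₀^σ}∘Φ_σ = Ψ_σ∘D_{U₀}`, `D*_{U₀^σ}∘Ψ_σ = Φ_σ∘D*_{U₀}`, `Δ_{U₀^σ}∘Φ_σ = Φ_σ∘Δ_{U₀}` — for EVERY background `U₀` with the SAME `Φ_σ, Ψ_σ`.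

WHAT IS PROVED (ns `…Theorems.Prop7LocalLaplacianGaugeCovariance`; member `F`, heights `n K`, weight `c₀ > 0`):
§1 `coe_gaugeAct_apply`, `toL2_symm_DL2_toL2S_apply_matrix` ((3.3) in matrices), ★★`toL2_symm_DL2_gaugeAct_conj`; §2 the three rows in `toL2`∕`toL2S` letters:
★`DL2_gaugeAct_toL2S_conj`, ★`DstarL2_gaugeAct_toL2_conj`, ★★`covLapSite_gaugeAct_toL2S_conj`; §3 `exists_adSite`, `exists_adBond`, ★★★`exists_adIsometries`
(`∃ Φ Ψ`, formulas + the three intertwining rows `∀ U₀`, = ✓`Prop7ProjectorGaugeCovariance`'s `hΔ`∕`hD`∕`DL2` hypotheses at the member).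
HONEST SCOPE.  Algebra of the stencils (3.3)∕(3.8); no estimate; the `Q″`-covariance row `hker` of the same consumer is NOT here (routeR-w3∕routeR-w4).

References: T. Bałaban, CMP **99** (1985) 389–434 [Balaban1985BackgroundPropagators] ((3.3) p.391, (3.8) p.392, (3.11) p.392, (3.23) p.394, p.393); CMP **98** (1985) 17–51
[Balaban1985Averaging] ((8) p.19, (18) p.21).
-/

set_option autoImplicit false

noncomputable section

open scoped Matrix.Norms.L2Operator BigOperators Matrix InnerProductSpace

namespace Summit.QuantumFields.YangMills.Theorems.Prop7LocalLaplacianGaugeCovariance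

open Literature.MathematicalPhysics.QuantumFieldTheory.Balaban1983to89
open Literature.MathematicalPhysics.QuantumFieldTheory.Balaban1983to89.T3ContinuumYM3Torus
open T3SectALandauChart (eta eta_pos)
open B11Eq103H1Complex (SiteL2K BondL2K)
open Summit.QuantumFields.YangMills.Theorems.Prop7SectET3Transport (periodsT3 bondEquiv bgOfCfg val_bgOfCfg isUnitaryBg_bgOfCfg)
open Summit.QuantumFields.YangMills.Theorems.Prop7SectET3HilbertLetters (W₂ toL2 toL2S DL2 DstarL2 covLapSite DL2_apply)
open Summit.QuantumFields.YangMills.Theorems.Prop7LocalDivergenceComparison (norm_toL2S_conj_eq norm_toL2_conj_eq toL2S_symm_DstarL2_gaugeAct_conj)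

variable (F : T3Family) (n K : ℕ) (c₀ : ℝ) [Fact (0 < c₀)]

/-! ## §1 (3.3) in matrices and its gauge covariance, bondwise -/

omit [Fact (0 < c₀)] in
/-- The gauged background in matrices: `↑(U₀^σ(b)) = σ(b₋)·U₀(b)·σ(b₊)*`. [cite: Balaban1985Averaging, (8) p.19] -/
theorem coe_gaugeAct_apply (σ : GaugeTransf (F.P K) 0 (Matrix.specialUnitaryGroup (Fin 2) ℂ)) (U₀ : GaugeField (F.P K) 0 (Matrix.specialUnitaryGroup (Fin 2) ℂ))
    (b : PBond (F.P K) 0) :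
    ((GaugeField.gaugeAct σ U₀ b : Matrix.specialUnitaryGroup (Fin 2) ℂ) : Matrix (Fin 2) (Fin 2) ℂ)
      = (σ b.src : Matrix (Fin 2) (Fin 2) ℂ) * (U₀ b : Matrix (Fin 2) (Fin 2) ℂ) * star (σ b.tgt : Matrix (Fin 2) (Fin 2) ℂ) := by
  show (((σ b.src * U₀ b * (σ b.tgt)⁻¹ : Matrix.specialUnitaryGroup (Fin 2) ℂ)) : Matrix (Fin 2) (Fin 2) ℂ) = _
  rw [Submonoid.coe_mul, Submonoid.coe_mul, ← Matrix.star_eq_inv]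
  rfl

/-- **(3.3) IN MATRICES**: `(D_{U₀}λ̃)(b) = η⁻¹·(U₀(b)·λ(b₊)·U₀(b)* − λ(b₋))` read back on the route carriers. [cite: Balaban1985BackgroundPropagators, (3.3) p.391] -/
theorem toL2_symm_DL2_toL2S_apply_matrix (U₀ : GaugeField (F.P K) 0 (Matrix.specialUnitaryGroup (Fin 2) ℂ)) (l : Site (F.P K) 0 → Matrix (Fin 2) (Fin 2) ℂ) (b : PBond (F.P K) 0) :
    (toL2 F K c₀).symm (DL2 F n K c₀ U₀ (toL2S F K c₀ l)) b
      = (((eta F n K : ℝ) : ℂ)⁻¹) • ((U₀ b : Matrix (Fin 2) (Fin 2) ℂ) * l b.tgt * star (U₀ b : Matrix (Fin 2) (Fin 2) ℂ) - l b.src) := by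
  have hinv : ((((bgOfCfg F K U₀ (bondEquiv F K b))⁻¹ : (Matrix (Fin 2) (Fin 2) ℂ)ˣ) : Matrix (Fin 2) (Fin 2) ℂ)) =
      star (((U₀ b : Matrix.specialUnitaryGroup (Fin 2) ℂ) : Matrix (Fin 2) (Fin 2) ℂ)) := by
    rw [isUnitaryBg_bgOfCfg, val_bgOfCfg, Equiv.symm_apply_apply]
  rw [DL2_apply, hinv]

/-- ★★ **GAUGE COVARIANCE OF `D_{U₀}` ON THE ROUTE CARRIERS**: `(D_{U₀^σ}(Ad_σλ)~)(b) = σ(b₋)·(D_{U₀}λ̃)(b)·σ(b₋)*` — the transporter at `b` meets `λ(b₊)` through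
`U₀^σ(b)·σ(b₊) = σ(b₋)·U₀(b)`. [cite: Balaban1985BackgroundPropagators, (3.3) p.391, p.393] -/
theorem toL2_symm_DL2_gaugeAct_conj (σ : GaugeTransf (F.P K) 0 (Matrix.specialUnitaryGroup (Fin 2) ℂ)) (U₀ : GaugeField (F.P K) 0 (Matrix.specialUnitaryGroup (Fin 2) ℂ))
    (l : Site (F.P K) 0 → Matrix (Fin 2) (Fin 2) ℂ) (b : PBond (F.P K) 0) :
    (toL2 F K c₀).symm (DL2 F n K c₀ (GaugeField.gaugeAct σ U₀)
        (toL2S F K c₀ (fun x => (σ x : Matrix (Fin 2) (Fin 2) ℂ) * l x * star (σ x : Matrix (Fin 2) (Fin 2) ℂ)))) b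
      = (σ b.src : Matrix (Fin 2) (Fin 2) ℂ) * (toL2 F K c₀).symm (DL2 F n K c₀ U₀ (toL2S F K c₀ l)) b * star (σ b.src : Matrix (Fin 2) (Fin 2) ℂ) := by
  rw [toL2_symm_DL2_toL2S_apply_matrix, toL2_symm_DL2_toL2S_apply_matrix, coe_gaugeAct_apply, Matrix.mul_smul, Matrix.smul_mul]
  congr 1
  set s : Matrix (Fin 2) (Fin 2) ℂ := (σ b.src : Matrix (Fin 2) (Fin 2) ℂ)
  set t : Matrix (Fin 2) (Fin 2) ℂ := (σ b.tgt : Matrix (Fin 2) (Fin 2) ℂ)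
  set u : Matrix (Fin 2) (Fin 2) ℂ := (U₀ b : Matrix (Fin 2) (Fin 2) ℂ)
  have htt : star t * t = 1 := Matrix.mem_unitaryGroup_iff'.mp (σ b.tgt).2.1
  rw [star_mul, star_mul, star_star]
  -- `(s u t*)·(t l₊ t*)·(t u* s*) − s l₋ s* = s·(u l₊ u* − l₋)·s*`
  have e1 : s * u * star t * (t * l b.tgt * star t) * (t * (star u * star s))
      = s * u * (star t * t) * l b.tgt * (star t * t) * star u * star s := by noncomm_ring
  rw [e1, htt]
  noncomm_ring

/-! ## §2 The three covariance rows in the `L²` letters -/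

/-- ★ **`D_{U₀^σ}(Ad_σλ)~ = (Ad_σ on bonds)(D_{U₀}λ̃)`** as vectors of `BondL2K`. [cite: Balaban1985BackgroundPropagators, (3.3) p.391, p.393] -/
theorem DL2_gaugeAct_toL2S_conj (σ : GaugeTransf (F.P K) 0 (Matrix.specialUnitaryGroup (Fin 2) ℂ)) (U₀ : GaugeField (F.P K) 0 (Matrix.specialUnitaryGroup (Fin 2) ℂ))
    (l : Site (F.P K) 0 → Matrix (Fin 2) (Fin 2) ℂ) :
    DL2 F n K c₀ (GaugeField.gaugeAct σ U₀) (toL2S F K c₀ (fun x => (σ x : Matrix (Fin 2) (Fin 2) ℂ) * l x * star (σ x : Matrix (Fin 2) (Fin 2) ℂ)))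
      = toL2 F K c₀ (fun b => (σ b.src : Matrix (Fin 2) (Fin 2) ℂ) * (toL2 F K c₀).symm (DL2 F n K c₀ U₀ (toL2S F K c₀ l)) b * star (σ b.src : Matrix (Fin 2) (Fin 2) ℂ)) :=
  (LinearEquiv.symm_apply_eq _).mp (funext fun b => toL2_symm_DL2_gaugeAct_conj F n K c₀ σ U₀ l b)

/-- ★ **`D*_{U₀^σ}(Ad_σA)~ = (Ad_σ on sites)(D*_{U₀}Ã)`** as vectors of `SiteL2K` (✓p750237's bondwise row, assembled). [cite: Balaban1985BackgroundPropagators, (3.8) p.392, p.393] -/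
theorem DstarL2_gaugeAct_toL2_conj (σ : GaugeTransf (F.P K) 0 (Matrix.specialUnitaryGroup (Fin 2) ℂ)) (U₀ : GaugeField (F.P K) 0 (Matrix.specialUnitaryGroup (Fin 2) ℂ))
    (X : PBond (F.P K) 0 → Matrix (Fin 2) (Fin 2) ℂ) :
    DstarL2 F n K c₀ (GaugeField.gaugeAct σ U₀) (toL2 F K c₀ (fun b => (σ b.src : Matrix (Fin 2) (Fin 2) ℂ) * X b * star (σ b.src : Matrix (Fin 2) (Fin 2) ℂ)))
      = toL2S F K c₀ (fun x => (σ x : Matrix (Fin 2) (Fin 2) ℂ) * (toL2S F K c₀).symm (DstarL2 F n K c₀ U₀ (toL2 F K c₀ X)) x * star (σ x : Matrix (Fin 2) (Fin 2) ℂ)) :=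
  (LinearEquiv.symm_apply_eq _).mp (funext fun x => toL2S_symm_DstarL2_gaugeAct_conj F n K c₀ σ U₀ X x)

/-- ★★ **`Δ^η_{U₀^σ}(Ad_σλ)~ = (Ad_σ on sites)(Δ^η_{U₀}λ̃)`** — (3.23) `Δ^η = D*D` composed from the two rows. [cite: Balaban1985BackgroundPropagators, (3.23) p.394, p.393] -/
theorem covLapSite_gaugeAct_toL2S_conj (σ : GaugeTransf (F.P K) 0 (Matrix.specialUnitaryGroup (Fin 2) ℂ)) (U₀ : GaugeField (F.P K) 0 (Matrix.specialUnitaryGroup (Fin 2) ℂ))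
    (l : Site (F.P K) 0 → Matrix (Fin 2) (Fin 2) ℂ) :
    covLapSite F n K c₀ (GaugeField.gaugeAct σ U₀) (toL2S F K c₀ (fun x => (σ x : Matrix (Fin 2) (Fin 2) ℂ) * l x * star (σ x : Matrix (Fin 2) (Fin 2) ℂ)))
      = toL2S F K c₀ (fun x => (σ x : Matrix (Fin 2) (Fin 2) ℂ) * (toL2S F K c₀).symm (covLapSite F n K c₀ U₀ (toL2S F K c₀ l)) x * star (σ x : Matrix (Fin 2) (Fin 2) ℂ)) := by
  simp only [covLapSite, LinearMap.coe_comp, Function.comp_apply]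
  rw [DL2_gaugeAct_toL2S_conj, DstarL2_gaugeAct_toL2_conj, LinearEquiv.apply_symm_apply]

/-! ## §3 The conjugations as linear isometries of the weighted `L²` spaces, and the export in ✓`Prop7ProjectorGaugeCovariance`'s letters -/

/-- **`Ad_σ` ON THE GAUGE PARAMETERS IS A LINEAR ISOMETRY OF `SiteL2K`** (∃-form, definition-free): `∃ Φ, ∀ λ, Φ(λ̃) = (σλσ*)~` (inverse `Ad_{σ*}`, norm by ✓`norm_toL2S_conj_eq`;
typed first by routeR-w3 g12, scratch a559a957). [cite: Balaban1985BackgroundPropagators, (3.11) p.392; Balaban1985Averaging, (18) p.21] -/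
theorem exists_adSite (σ : GaugeTransf (F.P K) 0 (Matrix.specialUnitaryGroup (Fin 2) ℂ)) :
    ∃ Φ : SiteL2K ℂ 3 (periodsT3 F K) c₀ W₂ ≃ₗᵢ[ℂ] SiteL2K ℂ 3 (periodsT3 F K) c₀ W₂,
      ∀ l : Site (F.P K) 0 → Matrix (Fin 2) (Fin 2) ℂ,
        Φ (toL2S F K c₀ l) = toL2S F K c₀ (fun x => (σ x : Matrix (Fin 2) (Fin 2) ℂ) * l x * star (σ x : Matrix (Fin 2) (Fin 2) ℂ)) := by
  have hss : ∀ x, star (σ x : Matrix (Fin 2) (Fin 2) ℂ) * (σ x : Matrix (Fin 2) (Fin 2) ℂ) = 1 := fun x => Matrix.mem_unitaryGroup_iff'.mp (σ x).2.1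
  have hss' : ∀ x, (σ x : Matrix (Fin 2) (Fin 2) ℂ) * star (σ x : Matrix (Fin 2) (Fin 2) ℂ) = 1 := fun x => Matrix.mem_unitaryGroup_iff.mp (σ x).2.1
  let L : (Site (F.P K) 0 → Matrix (Fin 2) (Fin 2) ℂ) ≃ₗ[ℂ] (Site (F.P K) 0 → Matrix (Fin 2) (Fin 2) ℂ) :=
    { toFun := fun l x => (σ x : Matrix (Fin 2) (Fin 2) ℂ) * l x * star (σ x : Matrix (Fin 2) (Fin 2) ℂ)
      invFun := fun l x => star (σ x : Matrix (Fin 2) (Fin 2) ℂ) * l x * (σ x : Matrix (Fin 2) (Fin 2) ℂ)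
      map_add' := fun l l' => by funext x; simp only [Pi.add_apply, Matrix.mul_add, Matrix.add_mul]
      map_smul' := fun c l => by funext x; simp only [Pi.smul_apply, RingHom.id_apply, Matrix.mul_smul, Matrix.smul_mul]
      left_inv := fun l => by
        funext x
        show star (σ x : Matrix (Fin 2) (Fin 2) ℂ) * ((σ x : Matrix (Fin 2) (Fin 2) ℂ) * l x * star (σ x : Matrix (Fin 2) (Fin 2) ℂ)) * (σ x : Matrix (Fin 2) (Fin 2) ℂ) = l x
        calc _ = (star (σ x : Matrix (Fin 2) (Fin 2) ℂ) * (σ x : Matrix (Fin 2) (Fin 2) ℂ)) * l x * (star (σ x : Matrix (Fin 2) (Fin 2) ℂ) * (σ x : Matrix (Fin 2) (Fin 2) ℂ)) := by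
                noncomm_ring
          _ = l x := by rw [hss, Matrix.one_mul, Matrix.mul_one]
      right_inv := fun l => by
        funext x
        show (σ x : Matrix (Fin 2) (Fin 2) ℂ) * (star (σ x : Matrix (Fin 2) (Fin 2) ℂ) * l x * (σ x : Matrix (Fin 2) (Fin 2) ℂ)) * star (σ x : Matrix (Fin 2) (Fin 2) ℂ) = l x
        calc _ = ((σ x : Matrix (Fin 2) (Fin 2) ℂ) * star (σ x : Matrix (Fin 2) (Fin 2) ℂ)) * l x * ((σ x : Matrix (Fin 2) (Fin 2) ℂ) * star (σ x : Matrix (Fin 2) (Fin 2) ℂ)) := by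
                noncomm_ring
          _ = l x := by rw [hss', Matrix.one_mul, Matrix.mul_one] }
  let E : SiteL2K ℂ 3 (periodsT3 F K) c₀ W₂ ≃ₗ[ℂ] SiteL2K ℂ 3 (periodsT3 F K) c₀ W₂ := ((toL2S F K c₀).symm.trans L).trans (toL2S F K c₀)
  have hE : ∀ l, E (toL2S F K c₀ l) = toL2S F K c₀ (fun x => (σ x : Matrix (Fin 2) (Fin 2) ℂ) * l x * star (σ x : Matrix (Fin 2) (Fin 2) ℂ)) := by
    intro l
    simp only [E, LinearEquiv.trans_apply, LinearEquiv.symm_apply_apply]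
    rfl
  refine ⟨{ E with norm_map' := fun v => ?_ }, hE⟩
  show ‖E v‖ = ‖v‖
  obtain ⟨l, rfl⟩ : ∃ l, v = toL2S F K c₀ l := ⟨(toL2S F K c₀).symm v, by rw [LinearEquiv.apply_symm_apply]⟩
  rw [hE, norm_toL2S_conj_eq]

/-- **`Ad_σ` ON THE VECTOR FIELDS (source conjugation) IS A LINEAR ISOMETRY OF `BondL2K`** (∃-form): `∃ Ψ, ∀ A, Ψ(Ã) = (σ(b₋)Aσ(b₋)*)~` (norm by ✓`norm_toL2_conj_eq`).
[cite: Balaban1985BackgroundPropagators, (3.11) p.392; Balaban1985Averaging, (18) p.21] -/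
theorem exists_adBond (σ : GaugeTransf (F.P K) 0 (Matrix.specialUnitaryGroup (Fin 2) ℂ)) :
    ∃ Ψ : BondL2K ℂ 3 (periodsT3 F K) c₀ W₂ ≃ₗᵢ[ℂ] BondL2K ℂ 3 (periodsT3 F K) c₀ W₂,
      ∀ X : PBond (F.P K) 0 → Matrix (Fin 2) (Fin 2) ℂ,
        Ψ (toL2 F K c₀ X) = toL2 F K c₀ (fun b => (σ b.src : Matrix (Fin 2) (Fin 2) ℂ) * X b * star (σ b.src : Matrix (Fin 2) (Fin 2) ℂ)) := by
  have hss : ∀ x, star (σ x : Matrix (Fin 2) (Fin 2) ℂ) * (σ x : Matrix (Fin 2) (Fin 2) ℂ) = 1 := fun x => Matrix.mem_unitaryGroup_iff'.mp (σ x).2.1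
  have hss' : ∀ x, (σ x : Matrix (Fin 2) (Fin 2) ℂ) * star (σ x : Matrix (Fin 2) (Fin 2) ℂ) = 1 := fun x => Matrix.mem_unitaryGroup_iff.mp (σ x).2.1
  let L : (PBond (F.P K) 0 → Matrix (Fin 2) (Fin 2) ℂ) ≃ₗ[ℂ] (PBond (F.P K) 0 → Matrix (Fin 2) (Fin 2) ℂ) :=
    { toFun := fun X b => (σ b.src : Matrix (Fin 2) (Fin 2) ℂ) * X b * star (σ b.src : Matrix (Fin 2) (Fin 2) ℂ)
      invFun := fun X b => star (σ b.src : Matrix (Fin 2) (Fin 2) ℂ) * X b * (σ b.src : Matrix (Fin 2) (Fin 2) ℂ)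
      map_add' := fun X X' => by funext b; simp only [Pi.add_apply, Matrix.mul_add, Matrix.add_mul]
      map_smul' := fun c X => by funext b; simp only [Pi.smul_apply, RingHom.id_apply, Matrix.mul_smul, Matrix.smul_mul]
      left_inv := fun X => by
        funext b
        show star (σ b.src : Matrix (Fin 2) (Fin 2) ℂ) * ((σ b.src : Matrix (Fin 2) (Fin 2) ℂ) * X b * star (σ b.src : Matrix (Fin 2) (Fin 2) ℂ)) *
            (σ b.src : Matrix (Fin 2) (Fin 2) ℂ) = X b
        calc _ = (star (σ b.src : Matrix (Fin 2) (Fin 2) ℂ) * (σ b.src : Matrix (Fin 2) (Fin 2) ℂ)) * X b *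
              (star (σ b.src : Matrix (Fin 2) (Fin 2) ℂ) * (σ b.src : Matrix (Fin 2) (Fin 2) ℂ)) := by noncomm_ring
          _ = X b := by rw [hss, Matrix.one_mul, Matrix.mul_one]
      right_inv := fun X => by
        funext b
        show (σ b.src : Matrix (Fin 2) (Fin 2) ℂ) * (star (σ b.src : Matrix (Fin 2) (Fin 2) ℂ) * X b * (σ b.src : Matrix (Fin 2) (Fin 2) ℂ)) *
            star (σ b.src : Matrix (Fin 2) (Fin 2) ℂ) = X b
        calc _ = ((σ b.src : Matrix (Fin 2) (Fin 2) ℂ) * star (σ b.src : Matrix (Fin 2) (Fin 2) ℂ)) * X b *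
              ((σ b.src : Matrix (Fin 2) (Fin 2) ℂ) * star (σ b.src : Matrix (Fin 2) (Fin 2) ℂ)) := by noncomm_ring
          _ = X b := by rw [hss', Matrix.one_mul, Matrix.mul_one] }
  let E : BondL2K ℂ 3 (periodsT3 F K) c₀ W₂ ≃ₗ[ℂ] BondL2K ℂ 3 (periodsT3 F K) c₀ W₂ := ((toL2 F K c₀).symm.trans L).trans (toL2 F K c₀)
  have hE : ∀ X, E (toL2 F K c₀ X) = toL2 F K c₀ (fun b => (σ b.src : Matrix (Fin 2) (Fin 2) ℂ) * X b * star (σ b.src : Matrix (Fin 2) (Fin 2) ℂ)) := by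
    intro X
    simp only [E, LinearEquiv.trans_apply, LinearEquiv.symm_apply_apply]
    rfl
  refine ⟨{ E with norm_map' := fun v => ?_ }, hE⟩
  show ‖E v‖ = ‖v‖
  obtain ⟨X, rfl⟩ : ∃ X, v = toL2 F K c₀ X := ⟨(toL2 F K c₀).symm v, by rw [LinearEquiv.apply_symm_apply]⟩
  rw [hE, norm_toL2_conj_eq]

/-- ★★★ **THE MEMBER `Φ`∕`Ψ`∕`hΔ` ROWS — EXPORT IN ✓`Prop7ProjectorGaugeCovariance`'s LETTERS.**  For a gauge transformation `σ` there are linear isometries `Φ` of `SiteL2K`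
(`Ad_σ` sitewise) and `Ψ` of `BondL2K` (`Ad_σ` at the source) — the SAME for every background — such that for every `U₀`:
`D_{U₀^σ}∘Φ = Ψ∘D_{U₀}`, `D*_{U₀^σ}∘Ψ = Φ∘D*_{U₀}` (the consumer's `hD`), `Δ^η_{U₀^σ}∘Φ = Φ∘Δ^η_{U₀}` (the consumer's `hΔ`).
[cite: Balaban1985BackgroundPropagators, (3.3) p.391, (3.8) p.392, (3.23) p.394, p.393] -/
theorem exists_adIsometries (σ : GaugeTransf (F.P K) 0 (Matrix.specialUnitaryGroup (Fin 2) ℂ)) :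
    ∃ (Φ : SiteL2K ℂ 3 (periodsT3 F K) c₀ W₂ ≃ₗᵢ[ℂ] SiteL2K ℂ 3 (periodsT3 F K) c₀ W₂)
      (Ψ : BondL2K ℂ 3 (periodsT3 F K) c₀ W₂ ≃ₗᵢ[ℂ] BondL2K ℂ 3 (periodsT3 F K) c₀ W₂),
      (∀ l : Site (F.P K) 0 → Matrix (Fin 2) (Fin 2) ℂ,
          Φ (toL2S F K c₀ l) = toL2S F K c₀ (fun x => (σ x : Matrix (Fin 2) (Fin 2) ℂ) * l x * star (σ x : Matrix (Fin 2) (Fin 2) ℂ))) ∧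
      (∀ X : PBond (F.P K) 0 → Matrix (Fin 2) (Fin 2) ℂ,
          Ψ (toL2 F K c₀ X) = toL2 F K c₀ (fun b => (σ b.src : Matrix (Fin 2) (Fin 2) ℂ) * X b * star (σ b.src : Matrix (Fin 2) (Fin 2) ℂ))) ∧
      ∀ U₀ : GaugeField (F.P K) 0 (Matrix.specialUnitaryGroup (Fin 2) ℂ),
        (∀ x, DL2 F n K c₀ (GaugeField.gaugeAct σ U₀) (Φ x) = Ψ (DL2 F n K c₀ U₀ x)) ∧
        (∀ A, DstarL2 F n K c₀ (GaugeField.gaugeAct σ U₀) (Ψ A) = Φ (DstarL2 F n K c₀ U₀ A)) ∧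
        (∀ x, covLapSite F n K c₀ (GaugeField.gaugeAct σ U₀) (Φ x) = Φ (covLapSite F n K c₀ U₀ x)) := by
  obtain ⟨Φ, hΦ⟩ := exists_adSite F K c₀ σ
  obtain ⟨Ψ, hΨ⟩ := exists_adBond F K c₀ σ
  refine ⟨Φ, Ψ, hΦ, hΨ, fun U₀ => ⟨fun x => ?_, fun A => ?_, fun x => ?_⟩⟩
  · obtain ⟨l, rfl⟩ : ∃ l, x = toL2S F K c₀ l := ⟨(toL2S F K c₀).symm x, by rw [LinearEquiv.apply_symm_apply]⟩
    rw [hΦ, DL2_gaugeAct_toL2S_conj, ← hΨ, LinearEquiv.apply_symm_apply]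
  · obtain ⟨X, rfl⟩ : ∃ X, A = toL2 F K c₀ X := ⟨(toL2 F K c₀).symm A, by rw [LinearEquiv.apply_symm_apply]⟩
    rw [hΨ, DstarL2_gaugeAct_toL2_conj, ← hΦ, LinearEquiv.apply_symm_apply]
  · obtain ⟨l, rfl⟩ : ∃ l, x = toL2S F K c₀ l := ⟨(toL2S F K c₀).symm x, by rw [LinearEquiv.apply_symm_apply]⟩
    rw [hΦ, covLapSite_gaugeAct_toL2S_conj, ← hΦ, LinearEquiv.apply_symm_apply]

end Summit.QuantumFields.YangMills.Theorems.Prop7LocalLaplacianGaugeCovariance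

end
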